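import Literature.Probability.RandomPlanarGeometry.HexSAWBrickWallSlabFugacity
import Literature.Probability.RandomPlanarGeometry.HexSAWBrickWallSlabLocality
import HarnessLib

/-!
# `μ_H(y)` of the armchair slabs as `H → ∞`: the limit exists for every `y > 0` and equals `μ_ℍ` for `0 < y ≤ 1`
# (Beaton 2014, Proposition 9, convergence part with a surface fugacity — desorbed side, translation-class model)

Topic `Literature/Probability/RandomPlanarGeometry` (continues `HexSAWBrickWallSlabFugacity.lean` — the partition functions
`HexBW.slabZ H n y = Ĉ_{H,n}(y,1)` of the `n`-step self-avoiding walks of the armchair slab `Slab_H = {0,…,H} × ℤ` of the brick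
wall (translation classes) with a fugacity `y` per vertex in the boundary column `x₀ = 0`, their growth rates
`HexBW.slabMuY H y = μ_H(y)`, `Ĉ_{H,n}(y)^{1/n} → μ_H(y)` (`H ≥ 1`) — and `HexSAWBrickWallSlabLocality.lean`:
`HexBW.tendsto_slabConnectiveConstant`, `μ(Slab_H) → μ_ℍ`).

Source: N. R. Beaton, *The critical surface fugacity of self-avoiding walks on a rotated honeycomb lattice*, J. Phys. A 47 (2014)
075003, arXiv:1210.0274v3, §3.2 Proposition 9 (p. 15): "For `y > 0`, `μ_T(1,y) < μ_{T+1}(1,y)`. Moreover, as `T → ∞`,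
`μ_T(1,y) → μ(y)`, where `μ(y)` is as defined in Proposition 7" (Proposition 7, p. 11: "For `0 < y ≤ 1`, `μ(y) = μ(1) = μ`"; Proposition 8,
p. 15: `μ_T(y,1) = μ_T(1,y)`), "The proof is virtually identical to that of Proposition 7 in [BBdGDCG14]".  The strict inequality
is `HexSAWBrickWallSlabFugacityStrict.lean`; THIS file treats the convergence part in the lane's translation-class model, by
COMPARISON with `y = 1` and the slab locality theorem of `HexSAWBrickWallSlabLocality.lean` — NOT by the printed route (unfolding
and the half-plane constant `μ(y)`); it is the armchair twin of `HexSAWBrickWallStripFugacityLocality.lean` (row strips):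

* for every `y > 0`, `H ↦ μ_H(y)` is non-decreasing on `H ≥ 1` (`slabMuY_mono`) and bounded by `max(1,y) μ_ℍ`, so the limit
  `lim_H μ_H(y) = sup_H μ_{H+1}(y)` EXISTS and lies in `[μ_ℍ, max(1,y) μ_ℍ]` (the lower bound because the walks of `Slab_H`
  shifted one column to the right — by an EVEN vector, `(1, ±1)` — are walks of `Slab_{H+1}` that never touch the column
  `x₀ = 0`: `μ(Slab_H) ≤ μ_{H+1}(y)`);
* for `0 < y ≤ 1` (the desorbed side), `Ĉ_{H,n}(y) ≤ c_n(Slab_H)` gives `μ_H(y) ≤ μ(Slab_H)`, hence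
  `μ(Slab_{H−1}) ≤ μ_H(y) ≤ μ(Slab_H)` and **`μ_H(y) → μ_ℍ`**.

The identification of `lim_H μ_H(y)` with Beaton's half-plane constant `μ(y)` for `y > 1` (unfolding) is NOT formalised here.
Label (lane «pcv-sawmu»): CONSOLIDATION of the convergence part of Proposition 9 on the desorbed side `y ≤ 1`, by a different
(comparison) proof; the window `[μ_ℍ, max(1,y) μ_ℍ]` for `y > 1` is elementary.

## Statements (namespace `Literature.Probability.RandomPlanarGeometry.SAW.HexBW`, all PROVED)

* `slabZ_le_slabCount` (`y ≤ 1`), `slabZ_le_pow_mul_slabCount` (`y ≥ 1`), `slabMuY_le_slabConnectiveConstant`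
  (`μ_H(y) ≤ μ(Slab_H)`, `y ≤ 1`, `H ≥ 1`), `slabMuY_le_mul_slabConnectiveConstant` (`μ_H(y) ≤ y μ(Slab_H)`, `y ≥ 1`),
  `slabMuY_le_max_mul` (`μ_H(y) ≤ max(1,y) μ_ℍ`);
* `slabLiftShift`, `slabLift`, `slabLift_mem`, `leftVisits_slabLift`, `slabLift_injective`, **`slabCount_le_slabZ_succ`**
  (`c_n(Slab_H) ≤ Ĉ_{H+1,n}(y)`), **`slabConnectiveConstant_le_slabMuY_succ`** (`μ(Slab_H) ≤ μ_{H+1}(y)`, `H ≥ 1`, every `y > 0`);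
* **`tendsto_slabMuY_of_le_one`** — `μ_H(y) → μ_ℍ` for `0 < y ≤ 1`; `bddAbove_range_slabMuY`, **`tendsto_slabMuY_ciSup`**
  (the limit exists for every `y > 0`), `hexConnectiveConstant_le_ciSup_slabMuY`, `ciSup_slabMuY_le`,
  `ciSup_slabMuY_of_le_one` (`sup_H μ_{H+1}(y) = μ_ℍ` for `0 < y ≤ 1`).
-/

noncomputable section

open Filter Topology Finset Literature.Probability.LatticeModels Literature.Probability.Percolation

namespace Literature.Probability.RandomPlanarGeometry.SAW.HexBW

/-! ### Comparison with `y = 1` from above -/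

/-- `c_n(Slab_H)` as a sum of ones over the translation classes. [cite: MadrasSlade1993, §8.2, eq. (8.2.1) (p. 267)] -/
theorem slabCount_eq_sum_one (H n : ℕ) : (slabCount H n : ℝ) = ∑ _p ∈ slabPairs H n, (1 : ℝ) := by
  rw [Finset.sum_const, nsmul_eq_mul, mul_one]
  rfl

/-- `Ĉ_{H,n}(y) ≤ c_n(Slab_H)` for `0 ≤ y ≤ 1`. [cite: Beaton2014RotatedHoneycomb, §3.2, Proposition 8 (arXiv:1210.0274v3 p. 15: Ĉ_{T,n}(y,z))] -/
theorem slabZ_le_slabCount (H n : ℕ) {y : ℝ} (hy0 : 0 ≤ y) (hy1 : y ≤ 1) : slabZ H n y ≤ slabCount H n := by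
  rw [slabCount_eq_sum_one]
  unfold slabZ
  exact Finset.sum_le_sum fun p _ => pow_le_one₀ hy0 hy1

/-- `Ĉ_{H,n}(y) ≤ y^{n+1} c_n(Slab_H)` for `y ≥ 1` (at most `n + 1` vertices in the boundary column).
[cite: Beaton2014RotatedHoneycomb, §3.2, Proposition 8 (arXiv:1210.0274v3 p. 15)] -/
theorem slabZ_le_pow_mul_slabCount (H n : ℕ) {y : ℝ} (hy : 1 ≤ y) : slabZ H n y ≤ y ^ (n + 1) * slabCount H n := by
  rw [slabCount_eq_sum_one, Finset.mul_sum]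
  unfold slabZ
  refine Finset.sum_le_sum fun p _ => ?_
  rw [mul_one]
  exact pow_le_pow_right₀ hy (leftVisits_le p.1 p.2 n)

/-- **`μ_H(y) ≤ μ(Slab_H)` for `0 < y ≤ 1`** (`H ≥ 1`). [cite: Beaton2014RotatedHoneycomb, §3.2, Propositions 8–9 (arXiv:1210.0274v3 p. 15)] -/
theorem slabMuY_le_slabConnectiveConstant {H : ℕ} (hH : 1 ≤ H) {y : ℝ} (hy0 : 0 < y) (hy1 : y ≤ 1) :
    slabMuY H y ≤ slabConnectiveConstant H :=
  le_of_tendsto_of_tendsto' (tendsto_slabZ_rpow hH hy0) (tendsto_slabCount_rpow hH) fun n =>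
    Real.rpow_le_rpow (slabZ_pos hH n hy0).le (slabZ_le_slabCount H n hy0.le hy1) (by positivity)

/-- `(y^{n+1})^{1/n} → y` for `y > 0`. [cite: MadrasSlade1993, Lemma 1.2.2 (p. 9)] -/
private theorem tendsto_pow_succ_rpow_one_div {y : ℝ} (hy : 0 < y) :
    Tendsto (fun n : ℕ => (y ^ (n + 1)) ^ (1 / (n : ℝ))) atTop (𝓝 y) := by
  -- `y^{1/n} → 1`
  have h1 : Tendsto (fun n : ℕ => y ^ (1 / (n : ℝ))) atTop (𝓝 1) := by
    have hl : Tendsto (fun n : ℕ => Real.log y / (n : ℝ)) atTop (𝓝 0) :=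
      tendsto_const_div_atTop_nhds_zero_nat _
    have h2 := (Real.continuous_exp.tendsto _).comp hl
    rw [Real.exp_zero] at h2
    refine h2.congr fun n => ?_
    rw [Function.comp_apply, Real.rpow_def_of_pos hy, mul_one_div]
  have h3 : Tendsto (fun n : ℕ => y * y ^ (1 / (n : ℝ))) atTop (𝓝 y) := by simpa using h1.const_mul y
  refine h3.congr' ?_
  filter_upwards [eventually_ge_atTop 1] with n hn
  have hn0 : (n : ℝ) ≠ 0 := by exact_mod_cast (by omega : n ≠ 0)
  rw [← Real.rpow_natCast, ← Real.rpow_mul hy.le, Nat.cast_succ, add_mul, one_mul, mul_one_div_cancel hn0,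
    Real.rpow_add hy, Real.rpow_one]

/-- **`μ_H(y) ≤ y μ(Slab_H)` for `y ≥ 1`** (`H ≥ 1`). [cite: Beaton2014RotatedHoneycomb, §3.2, Proposition 8 (arXiv:1210.0274v3 p. 15)] -/
theorem slabMuY_le_mul_slabConnectiveConstant {H : ℕ} (hH : 1 ≤ H) {y : ℝ} (hy : 1 ≤ y) :
    slabMuY H y ≤ y * slabConnectiveConstant H := by
  have hy0 : 0 < y := by linarith
  have hlim := (tendsto_pow_succ_rpow_one_div hy0).mul (tendsto_slabCount_rpow hH)
  refine le_of_tendsto_of_tendsto' (tendsto_slabZ_rpow hH hy0) hlim fun n => ?_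
  rw [← Real.mul_rpow (pow_nonneg hy0.le _) (Nat.cast_nonneg _)]
  exact Real.rpow_le_rpow (slabZ_pos hH n hy0).le (slabZ_le_pow_mul_slabCount H n hy) (by positivity)

/-- **`μ_H(y) ≤ max(1,y) μ_ℍ`** for every `y > 0` (`H ≥ 1`). [cite: Beaton2014RotatedHoneycomb, §3.2, Proposition 8 (arXiv:1210.0274v3 p. 15: μ_T(y,z) is finite)] -/
theorem slabMuY_le_max_mul {H : ℕ} (hH : 1 ≤ H) {y : ℝ} (hy : 0 < y) :
    slabMuY H y ≤ max 1 y * hexConnectiveConstant := by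
  have hμ := slabConnectiveConstant_le hH
  have hμ0 := (slabConnectiveConstant_pos hH).le
  rcases le_or_gt y 1 with h1 | h1
  · rw [max_eq_left h1, one_mul]
    exact (slabMuY_le_slabConnectiveConstant hH hy h1).trans hμ
  · rw [max_eq_right h1.le]
    exact (slabMuY_le_mul_slabConnectiveConstant hH h1.le).trans (mul_le_mul_of_nonneg_left hμ hy.le)

/-! ### Comparison from below: the walks of `Slab_H` shifted one column into `Slab_{H+1}` -/

/-- The shift vector of a starting site `a`: `(1, 1 − 2a₁)` — one column to the right, and one row up or down so that the
parity of the site (hence the brick-wall bonds) is preserved and the new start is again in the cross-section `… × {0,1}`.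
[cite: MadrasSlade1993, §8.2, eq. (8.2.1) (p. 267)] -/
def slabLiftShift (a : Site 2) : Site 2 := fun i => if i = 0 then 1 else 1 - 2 * a 1

/-- Coordinate `0` of the shift vector. [cite: MadrasSlade1993, §8.2, eq. (8.2.1) (p. 267)] -/
@[simp] theorem slabLiftShift_apply_zero (a : Site 2) : slabLiftShift a 0 = 1 := if_pos rfl

/-- Coordinate `1` of the shift vector. [cite: MadrasSlade1993, §8.2, eq. (8.2.1) (p. 267)] -/
@[simp] theorem slabLiftShift_apply_one (a : Site 2) : slabLiftShift a 1 = 1 - 2 * a 1 := if_neg (by decide)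

/-- The shift vector has even coordinate sum (a translation of the brick wall).
[cite: EntingJensen2009, §7.4.2, Fig. 7.10 (brickwork form of the honeycomb lattice)] -/
theorem slabLiftShift_even (a : Site 2) : (slabLiftShift a 0 + slabLiftShift a 1) % 2 = 0 := by
  rw [slabLiftShift_apply_zero, slabLiftShift_apply_one]; omega

/-- The shift of a translation class `(a, υ)`: same shape, start moved by the shift vector.
[cite: MadrasSlade1993, §8.2, eq. (8.2.1) (p. 267)] -/
def slabLift (p : Site 2 × (ℕ → Site 2)) : Site 2 × (ℕ → Site 2) := (slabLiftShift p.1 + p.1, p.2)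

/-- The shift of a walk of `Slab_H` is a walk of `Slab_{H+1}`. [cite: MadrasSlade1993, §8.2 (p. 267)] -/
theorem slabLift_mem {H n : ℕ} {p : Site 2 × (ℕ → Site 2)} (hp : p ∈ slabPairs H n) :
    slabLift p ∈ slabPairs (H + 1) n := by
  obtain ⟨a, υ⟩ := p
  rw [mem_slabPairs] at hp ⊢
  dsimp only at hp
  obtain ⟨ha, hυ, hbw, hR⟩ := hp
  rw [mem_slabStarts] at ha
  obtain ⟨⟨ha0, ha0'⟩, ha1, ha1'⟩ := ha
  refine ⟨?_, hυ, fun i hi => ?_, fun m hm => ?_⟩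
  · show slabLiftShift a + a ∈ slabStarts (H + 1)
    rw [mem_slabStarts]
    refine ⟨⟨?_, ?_⟩, ?_, ?_⟩ <;>
      simp only [Pi.add_apply, slabLiftShift_apply_zero, slabLiftShift_apply_one, Nat.cast_add, Nat.cast_one] <;> omega
  · show brickWallGraph.Adj (slabLiftShift a + a + υ i) (slabLiftShift a + a + υ (i + 1))
    rw [add_assoc, add_assoc, adj_add_left_iff_of_even (slabLiftShift_even a)]
    exact hbw i hi
  · show InSlab (H + 1) (slabLiftShift a + a + υ m)
    have h := hR m hm
    simp only [InSlab, Pi.add_apply, slabLiftShift_apply_zero, Nat.cast_add, Nat.cast_one] at h ⊢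
    omega

/-- A shifted walk has no vertex in the boundary column `x₀ = 0`. [cite: Beaton2014RotatedHoneycomb, §3.2 (arXiv:1210.0274v3 p. 15)] -/
theorem leftVisits_slabLift {H n : ℕ} {p : Site 2 × (ℕ → Site 2)} (hp : p ∈ slabPairs H n) :
    leftVisits (slabLift p).1 (slabLift p).2 n = 0 := by
  obtain ⟨a, υ⟩ := p
  rw [mem_slabPairs] at hp
  dsimp only at hp
  obtain ⟨-, -, -, hR⟩ := hp
  show leftVisits (slabLiftShift a + a) υ n = 0
  unfold leftVisits
  refine Finset.sum_eq_zero fun m hm => ?_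
  rw [Finset.mem_range] at hm
  have h := (hR m (by omega)).1
  simp only [Pi.add_apply, slabLiftShift_apply_zero] at h ⊢
  rw [if_neg (by omega)]

/-- The shift is injective. [cite: MadrasSlade1993, §8.2 (p. 267)] -/
theorem slabLift_injective : Function.Injective slabLift := by
  rintro ⟨a, υ⟩ ⟨a', υ'⟩ h
  simp only [slabLift, Prod.mk.injEq] at h
  obtain ⟨h1, rfl⟩ := h
  have h0 := congrFun h1 0
  have h1' := congrFun h1 1
  simp only [Pi.add_apply, slabLiftShift_apply_zero, slabLiftShift_apply_one] at h0 h1'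
  have e0 : a 0 = a' 0 := by omega
  have e1 : a 1 = a' 1 := by omega
  have : a = a' := by
    funext i; fin_cases i
    · exact e0
    · exact e1
  rw [this]

/-- **`c_n(Slab_H) ≤ Ĉ_{H+1,n}(y)`** for every `y > 0`: the shifted walks of `Slab_H` have weight `y⁰ = 1` in `Slab_{H+1}`.
[cite: Beaton2014RotatedHoneycomb, §3.2, Proposition 9 (arXiv:1210.0274v3 p. 15)] -/
theorem slabCount_le_slabZ_succ (H n : ℕ) {y : ℝ} (hy : 0 < y) : (slabCount H n : ℝ) ≤ slabZ (H + 1) n y := by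
  classical
  have hsub : (slabPairs H n).image slabLift ⊆ slabPairs (H + 1) n := by
    intro q hq
    obtain ⟨p, hp, rfl⟩ := Finset.mem_image.1 hq
    exact slabLift_mem hp
  calc (slabCount H n : ℝ) = ∑ _q ∈ (slabPairs H n).image slabLift, (1 : ℝ) := by
        rw [Finset.sum_const, nsmul_eq_mul, mul_one, Finset.card_image_of_injective _ slabLift_injective]
        rfl
    _ = ∑ q ∈ (slabPairs H n).image slabLift, y ^ leftVisits q.1 q.2 n := by
        refine Finset.sum_congr rfl fun q hq => ?_
        obtain ⟨p, hp, rfl⟩ := Finset.mem_image.1 hq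
        rw [leftVisits_slabLift hp, pow_zero]
    _ ≤ slabZ (H + 1) n y := by
        unfold slabZ
        exact Finset.sum_le_sum_of_subset_of_nonneg hsub fun _ _ _ => pow_nonneg hy.le _

/-- **`μ(Slab_H) ≤ μ_{H+1}(y)` for every `y > 0`** (`H ≥ 1`). [cite: Beaton2014RotatedHoneycomb, §3.2, Proposition 9 (arXiv:1210.0274v3 p. 15: μ_T(1,y) → μ(y), and μ(y) ≥ μ)] -/
theorem slabConnectiveConstant_le_slabMuY_succ {H : ℕ} (hH : 1 ≤ H) {y : ℝ} (hy : 0 < y) :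
    slabConnectiveConstant H ≤ slabMuY (H + 1) y :=
  le_of_tendsto_of_tendsto' (tendsto_slabCount_rpow hH) (tendsto_slabZ_rpow (by omega) hy) fun n =>
    Real.rpow_le_rpow (Nat.cast_nonneg _) (slabCount_le_slabZ_succ H n hy) (by positivity)

/-! ### The limit `H → ∞` -/

/-- **Beaton Proposition 9, convergence part, desorbed side: `μ_H(y) → μ_ℍ` as `H → ∞` for `0 < y ≤ 1`**
(translation-class model; there `μ(y) = μ(1) = μ` for `0 < y ≤ 1`, Proposition 7 p. 11).
[cite: Beaton2014RotatedHoneycomb, §3.2 Proposition 9 (arXiv v3 p. 15: "Moreover, as T → ∞, μ_T(1,y) → μ(y)") with Proposition 7 (p. 11)] -/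
theorem tendsto_slabMuY_of_le_one {y : ℝ} (hy0 : 0 < y) (hy1 : y ≤ 1) :
    Tendsto (fun H : ℕ => slabMuY H y) atTop (𝓝 hexConnectiveConstant) := by
  have hlow : Tendsto (fun H : ℕ => slabConnectiveConstant (H - 1)) atTop (𝓝 hexConnectiveConstant) :=
    tendsto_slabConnectiveConstant.comp (tendsto_sub_atTop_nat 1)
  refine tendsto_of_tendsto_of_tendsto_of_le_of_le' hlow tendsto_const_nhds ?_ ?_
  · filter_upwards [eventually_ge_atTop 2] with H hH
    have h := slabConnectiveConstant_le_slabMuY_succ (H := H - 1) (by omega) hy0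
    rwa [Nat.sub_add_cancel (by omega : 1 ≤ H)] at h
  · filter_upwards [eventually_ge_atTop 1] with H hH
    exact (slabMuY_le_slabConnectiveConstant hH hy0 hy1).trans (slabConnectiveConstant_le hH)

/-- `H ↦ μ_{H+1}(y)` is bounded above (by `max(1,y) μ_ℍ`). [cite: Beaton2014RotatedHoneycomb, §3.2, Proposition 8 (arXiv:1210.0274v3 p. 15)] -/
theorem bddAbove_range_slabMuY {y : ℝ} (hy : 0 < y) : BddAbove (Set.range fun H : ℕ => slabMuY (H + 1) y) :=
  ⟨max 1 y * hexConnectiveConstant, by rintro _ ⟨H, rfl⟩; exact slabMuY_le_max_mul (by omega) hy⟩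

/-- **The limit `lim_H μ_H(y)` exists for every `y > 0`** (`= sup_H μ_{H+1}(y)`: non-decreasing on `H ≥ 1` and bounded).
[cite: Beaton2014RotatedHoneycomb, §3.2 Proposition 9 (arXiv v3 p. 15: "as T → ∞, μ_T(1,y) → μ(y)")] -/
theorem tendsto_slabMuY_ciSup {y : ℝ} (hy : 0 < y) :
    Tendsto (fun H : ℕ => slabMuY H y) atTop (𝓝 (⨆ H : ℕ, slabMuY (H + 1) y)) := by
  have hmono : Monotone fun H : ℕ => slabMuY (H + 1) y := fun a b h => slabMuY_mono (by omega) (by omega) hy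
  have h := tendsto_atTop_ciSup hmono (bddAbove_range_slabMuY hy)
  exact (tendsto_add_atTop_iff_nat 1).1 h

/-- **`μ_ℍ ≤ lim_H μ_H(y)`** for every `y > 0`. [cite: Beaton2014RotatedHoneycomb, §3.2 Proposition 9 (arXiv v3 p. 15) with Proposition 7 (p. 11: μ(y) ≥ max{μ, √y})] -/
theorem hexConnectiveConstant_le_ciSup_slabMuY {y : ℝ} (hy : 0 < y) :
    hexConnectiveConstant ≤ ⨆ H : ℕ, slabMuY (H + 1) y := by
  have h1 : Tendsto (fun H : ℕ => slabConnectiveConstant (H + 1)) atTop (𝓝 hexConnectiveConstant) :=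
    tendsto_slabConnectiveConstant.comp (tendsto_add_atTop_nat 1)
  have h2 : Tendsto (fun H : ℕ => slabMuY (H + 1 + 1) y) atTop (𝓝 (⨆ H : ℕ, slabMuY (H + 1) y)) :=
    (tendsto_slabMuY_ciSup hy).comp (tendsto_add_atTop_nat 2)
  exact le_of_tendsto_of_tendsto' h1 h2 fun H => slabConnectiveConstant_le_slabMuY_succ (by omega) hy

/-- `lim_H μ_H(y) ≤ max(1,y) μ_ℍ`. [cite: Beaton2014RotatedHoneycomb, §3.2, Proposition 8 (arXiv:1210.0274v3 p. 15)] -/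
theorem ciSup_slabMuY_le {y : ℝ} (hy : 0 < y) : (⨆ H : ℕ, slabMuY (H + 1) y) ≤ max 1 y * hexConnectiveConstant :=
  ciSup_le fun H => slabMuY_le_max_mul (by omega) hy

/-- **`sup_H μ_{H+1}(y) = μ_ℍ` for `0 < y ≤ 1`.** [cite: Beaton2014RotatedHoneycomb, §3.2 Proposition 9 (arXiv v3 p. 15) with Proposition 7 (p. 11)] -/
theorem ciSup_slabMuY_of_le_one {y : ℝ} (hy0 : 0 < y) (hy1 : y ≤ 1) :
    (⨆ H : ℕ, slabMuY (H + 1) y) = hexConnectiveConstant :=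
  tendsto_nhds_unique (tendsto_slabMuY_ciSup hy0) (tendsto_slabMuY_of_le_one hy0 hy1)

end Literature.Probability.RandomPlanarGeometry.SAW.HexBW
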